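import Literature.AnabelianGeometry.SemiGraphs.QuasiTemperoidsThmA4Unique
import Literature.AnabelianGeometry.SemiGraphs.OverPrimeDownwardClosed
import Literature.AnabelianGeometry.SemiGraphs.OverPrimeProd
import Literature.AnabelianGeometry.SemiGraphs.BTempProdColimits
import Mathlib.CategoryTheory.Limits.Preserves.FunctorCategory
import HarnessLib

/-!
# Semi-graphs of anabelioids, Appendix, proof of Theorem A.4: the ČECH NERVE `X × A × A ⇉ X × A → X`
# in `B^temp(Π)` and the functor `X ↦ (K X ⇉ P X)` with values in diagrams of `T[A]`

Mochizuki, *Semi-graphs of anabelioids*, Publ. RIMS **42** (2006) 221–322, Appendix, Theorem A.4 and its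
proof, manuscript pp. 82–86 (PRIMS pp. 312–316) [cite: MochizukiSemiAnbd2006, Thm A.4 pp.82-86]: a
morphism of quasi-temperoids `φ : T₁[A₁] → T₂[A₂]` extends to a morphism of temperoids
`ψ : T₁ → T₂`; print constructs `ψ^*` through the categories `D_i`, `P_i` (pp. 83–85).  The abc-iut
cell's row **A4-∃** (`plan/L3/SUBDAG-SemiAnbd-Cor311.md`, holder abc-iut-w5-d129; holder's cut
2026-08-26T03:36Z / L3-lead ruling α20, file **E1**, seat abc-iut-w5-d220) builds `ψ^*` instead by the
coequaliser presentation `ψ^*(X) := coeq(φ^*(X × A₂ × A₂) ⇉ φ^*(X × A₂))` — every object `X` of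
`T₂ = B^temp(Π₂)` is covered by the object `X × A₂` of `Q₂ = T₂[A₂]`, with kernel pair `X × A₂ × A₂`
(the presentation already used by the tree's uniqueness proof, `QuasiTemperoidsThmA4Unique.lean` §1,
abc-iut-w5-d106).  This file is the NERVE: for `T = B^temp(Π)` (`Π` any topological group, any
`HasFiniteLimits` instance — they exist, `BTemp.hasFiniteLimits`) and `A : T`,

* `BTemp.cechP A X := X ⨯ A`, `BTemp.cechK A X := (X ⨯ A) ⨯ A`, `cechk₁ := pr₁`, `cechk₂ := pr₁ ⨯ 𝟙_A`
  (reducible abbreviations = the holder's SPEC terms, `HOME/staging/w5/w5-d129/CechDefs.SCRATCH.lean`),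
  `cech_condition : k₁ ≫ pr₁ = k₂ ≫ pr₁`, and the same as objects / arrows of `T[A] = Over' A`
  (`cechPOver`, `cechKOver`, `cechPMap`, `cechKMap`);
* (i) **`BTemp.isLimit_cechKernelPair`** — `K X ⇉ P X` IS the kernel pair of `pr₁ : X ⨯ A → X` (pure
  category theory);
* (ii) **`BTemp.isColimit_cechCofork (a₀) X`** — `K X ⇉ P X → X` is a COEQUALISER in `B^temp(Π)` as soon as
  `A` has a point (abc-iut-w5-d106's `BTemp.nonempty_isColimit_cofork_of_isLimit`, by name);
* (iii) **`BTemp.cechPair A : B^temp(Π) ⥤ (WalkingParallelPair ⥤ T[A])`**, `X ↦ (K X ⇉ P X)` (the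
  holder's term verbatim), its evaluations `cechPair ⋙ ev₁ ≅ prodA`, `cechPair ⋙ ev₀ ≅ prodA ⋙ ι ⋙ prodA`
  (identity components), hence **`BTemp.preservesColimitsOfShape_cechPair_whiskeringRight`**: for any
  `Φ : T[A] ⥤ D` preserving colimits of a countable shape `J`, `X ↦ Φ(K X ⇉ P X)` preserves them
  (`X ↦ X ⨯ A` does, `BTempProdColimits.lean`; `prodA`, `OverPrime.preservesColimitsOfShape_prodA`);
* the AUGMENTATION over objects of `T[A]`: `BTemp.cechCoforkOver A B` (`K B ⇉ P B → B` as a cofork IN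
  `T[A]`), **`isColimit_cechCoforkOver (a₀) B`** (a colimit in `T[A]`: the inclusion reflects it,
  `OverPrimeDownwardClosed.lean`), and its naturality in `B` packaged as the natural transformation
  **`BTemp.cechAug A : ι ⋙ cechPair A ⟶ Functor.const _`** — exactly the fields `nerve`/`cocone`/
  `naturality`/`isColimit` of abc-iut-w4-d081's `ThmA4Cech.CechPresentation` (`ThmA4CechPresentation.lean`)
  resp. the binders `(N, aug, haug)` of abc-iut-L3-t5's `ThmA4Cech.cechExtension(Iso)`; the squares of the
  nerve needed for finite limits are abc-iut-w4-d048's `CechNerveSquares.lean`.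

Elementary; nothing refers to the IUT corpus and no side is taken on any disputed claim.
-/

namespace Literature.AnabelianGeometry.SemiGraphs

open CategoryTheory CategoryTheory.Limits

universe w v₃ u₃ u

namespace BTemp

variable {G : Type u} [Group G] [TopologicalSpace G] [HasFiniteLimits (BTemp G)] (A : BTemp G)

/-! ### The nerve: `K X ⇉ P X`, `P X = X × A`, `K X = X × A × A` -/

/-- `P X := X × A` (an object of `T[A]` via the second projection). [cite: MochizukiSemiAnbd2006, Thm A.4 pp.82-86] -/
noncomputable abbrev cechP (X : BTemp G) : BTemp G := X ⨯ A

/-- `K X := (X × A) × A` (the kernel pair of `X × A → X`, written as an iterated product).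
[cite: MochizukiSemiAnbd2006, Thm A.4 pp.82-86] -/
noncomputable abbrev cechK (X : BTemp G) : BTemp G := (X ⨯ A) ⨯ A

/-- `k₁ : (x, a, a′) ↦ (x, a)`. [cite: MochizukiSemiAnbd2006, Thm A.4 pp.82-86] -/
noncomputable abbrev cechk₁ (X : BTemp G) : cechK A X ⟶ cechP A X := prod.fst

/-- `k₂ : (x, a, a′) ↦ (x, a′)`. [cite: MochizukiSemiAnbd2006, Thm A.4 pp.82-86] -/
noncomputable abbrev cechk₂ (X : BTemp G) : cechK A X ⟶ cechP A X := prod.map prod.fst (𝟙 A)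

/-- `k₁ ≫ pr₁ = k₂ ≫ pr₁`. [cite: MochizukiSemiAnbd2006, Thm A.4 pp.82-86] -/
theorem cech_condition (X : BTemp G) :
    cechk₁ A X ≫ (prod.fst : cechP A X ⟶ X) = cechk₂ A X ≫ prod.fst := by
  simp

/-- `P X` as an object of `T[A] = Over' A`. [cite: MochizukiSemiAnbd2006, Thm A.4 pp.82-86] -/
noncomputable def cechPOver (X : BTemp G) : Over' A := ⟨cechP A X, ⟨prod.snd⟩⟩

/-- `K X` as an object of `T[A] = Over' A`. [cite: MochizukiSemiAnbd2006, Thm A.4 pp.82-86] -/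
noncomputable def cechKOver (X : BTemp G) : Over' A := ⟨cechK A X, ⟨prod.snd⟩⟩

/-- The map `P f : X × A → Y × A`. [cite: MochizukiSemiAnbd2006, Thm A.4 pp.82-86] -/
noncomputable abbrev cechPMap {X Y : BTemp G} (f : X ⟶ Y) : cechP A X ⟶ cechP A Y := prod.map f (𝟙 A)

/-- The map `K f : (X × A) × A → (Y × A) × A`. [cite: MochizukiSemiAnbd2006, Thm A.4 pp.82-86] -/
noncomputable abbrev cechKMap {X Y : BTemp G} (f : X ⟶ Y) : cechK A X ⟶ cechK A Y :=
  prod.map (prod.map f (𝟙 A)) (𝟙 A)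

/-- `k₁` is natural. [cite: MochizukiSemiAnbd2006, Thm A.4 pp.82-86] -/
theorem cechk₁_naturality {X Y : BTemp G} (f : X ⟶ Y) :
    cechk₁ A X ≫ cechPMap A f = cechKMap A f ≫ cechk₁ A Y := by
  simp

/-- `k₂` is natural. [cite: MochizukiSemiAnbd2006, Thm A.4 pp.82-86] -/
theorem cechk₂_naturality {X Y : BTemp G} (f : X ⟶ Y) :
    cechk₂ A X ≫ cechPMap A f = cechKMap A f ≫ cechk₂ A Y := by
  simp

/-! ### (i) `K X ⇉ P X` is the kernel pair of `P X → X` -/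

/-- **`(X × A) × A ⇉ X × A` is the kernel pair of `pr₁ : X × A → X`** (a pullback cone of `pr₁` against
itself: `((x, a), (x′, a′))` with `x = x′` is `(x, a, a′)`). [cite: MochizukiSemiAnbd2006, Thm A.4 pp.82-86] -/
noncomputable def isLimit_cechKernelPair (X : BTemp G) :
    IsLimit (PullbackCone.mk (cechk₁ A X) (cechk₂ A X) (cech_condition A X)) :=
  PullbackCone.IsLimit.mk _ (fun s => prod.lift s.fst (s.snd ≫ prod.snd))
    (fun s => prod.lift_fst _ _)
    (fun s => by
      apply Limits.prod.hom_ext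
      · change (prod.lift s.fst (s.snd ≫ prod.snd) ≫ prod.map prod.fst (𝟙 A)) ≫ prod.fst =
          s.snd ≫ prod.fst
        rw [Category.assoc, prod.map_fst, ← Category.assoc, prod.lift_fst]
        exact s.condition
      · change (prod.lift s.fst (s.snd ≫ prod.snd) ≫ prod.map prod.fst (𝟙 A)) ≫ prod.snd =
          s.snd ≫ prod.snd
        rw [Category.assoc, prod.map_snd, Category.comp_id, prod.lift_snd])
    (fun s m h₁ h₂ => by
      apply Limits.prod.hom_ext
      · rw [prod.lift_fst]
        exact h₁
      · rw [prod.lift_snd, ← h₂]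
        change m ≫ prod.snd = (m ≫ prod.map prod.fst (𝟙 A)) ≫ prod.snd
        rw [Category.assoc, prod.map_snd, Category.comp_id])

/-! ### (ii) `K X ⇉ P X → X` is a coequaliser -/

/-- **`(X × A) × A ⇉ X × A → X` is a COEQUALISER in `B^temp(Π)`** when `A` has a point `a₀` (the kernel
pair of the surjection `X × A → X`; `nonempty_isColimit_cofork_of_isLimit`).
[cite: MochizukiSemiAnbd2006, Thm A.4 pp.82-86] -/
noncomputable def isColimit_cechCofork (a₀ : A.obj.V) (X : BTemp G) :
    IsColimit (Cofork.ofπ (prod.fst : cechP A X ⟶ X) (cech_condition A X)) :=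
  (nonempty_isColimit_cofork_of_isLimit (prod.fst : cechP A X ⟶ X) prod.snd (prodIsProd X A) a₀
    (cechk₁ A X) (cechk₂ A X) (cech_condition A X) (isLimit_cechKernelPair A X)).some

/-! ### (iii) The functor `X ↦ (K X ⇉ P X)` with values in diagrams of `T[A]` -/

/-- **The Čech pair functor** `X ↦ (K X ⇉ P X)` with values in diagrams in `T[A] = Over' A`.
[cite: MochizukiSemiAnbd2006, Thm A.4 pp.82-86] -/
noncomputable def cechPair : BTemp G ⥤ (WalkingParallelPair ⥤ Over' A) where
  obj X := parallelPair (ObjectProperty.homMk (cechk₁ A X) : cechKOver A X ⟶ cechPOver A X)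
    (ObjectProperty.homMk (cechk₂ A X))
  map f := parallelPairHom _ _ _ _ (ObjectProperty.homMk (cechKMap A f))
    (ObjectProperty.homMk (cechPMap A f))
    (by ext : 1; exact (cechk₁_naturality A f)) (by ext : 1; exact (cechk₂_naturality A f))
  map_id X := by
    ext j : 2
    cases j <;> (apply ObjectProperty.hom_ext; simp [cechKMap, cechPMap, cechKOver, cechPOver])
  map_comp f g := by
    ext j : 2
    cases j <;> (apply ObjectProperty.hom_ext; simp [cechKMap, cechPMap, cechKOver, cechPOver])

/-- `cechPair` at the object `one` is `P X` in `T[A]`. [cite: MochizukiSemiAnbd2006, Thm A.4 pp.82-86] -/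
@[simp] theorem cechPair_obj_obj_one (X : BTemp G) :
    ((cechPair A).obj X).obj WalkingParallelPair.one = cechPOver A X := rfl

/-- `cechPair` at the object `zero` is `K X` in `T[A]`. [cite: MochizukiSemiAnbd2006, Thm A.4 pp.82-86] -/
@[simp] theorem cechPair_obj_obj_zero (X : BTemp G) :
    ((cechPair A).obj X).obj WalkingParallelPair.zero = cechKOver A X := rfl

/-- `cechPair` on arrows at `one` is `P f`. [cite: MochizukiSemiAnbd2006, Thm A.4 pp.82-86] -/
@[simp] theorem cechPair_map_app_one {X Y : BTemp G} (f : X ⟶ Y) :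
    (((cechPair A).map f).app WalkingParallelPair.one).hom = cechPMap A f := rfl

/-- `cechPair` on arrows at `zero` is `K f`. [cite: MochizukiSemiAnbd2006, Thm A.4 pp.82-86] -/
@[simp] theorem cechPair_map_app_zero {X Y : BTemp G} (f : X ⟶ Y) :
    (((cechPair A).map f).app WalkingParallelPair.zero).hom = cechKMap A f := rfl

/-- **Evaluating the nerve at `one` gives `X ↦ (X × A → A)`** (`OverPrime.prodA`, identity components).
[cite: MochizukiSemiAnbd2006, Thm A.4 pp.82-86] -/
noncomputable def cechPairEvalOneIso :
    cechPair A ⋙ (evaluation WalkingParallelPair (Over' A)).obj WalkingParallelPair.one ≅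
      OverPrime.prodA A :=
  NatIso.ofComponents (fun _ => Iso.refl _) (fun f => by
    ext : 1
    change cechPMap A f ≫ 𝟙 _ = 𝟙 _ ≫ prod.map f (𝟙 A)
    rw [Category.comp_id, Category.id_comp])

/-- **Evaluating the nerve at `zero` gives `X ↦ ((X × A) × A → A)`** (`prodA` applied twice, identity
components). [cite: MochizukiSemiAnbd2006, Thm A.4 pp.82-86] -/
noncomputable def cechPairEvalZeroIso :
    cechPair A ⋙ (evaluation WalkingParallelPair (Over' A)).obj WalkingParallelPair.zero ≅
      OverPrime.prodA A ⋙ (admitsHomTo A).ι ⋙ OverPrime.prodA A :=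
  NatIso.ofComponents (fun _ => Iso.refl _) (fun f => by
    ext : 1
    change cechKMap A f ≫ 𝟙 _ = 𝟙 _ ≫ prod.map (prod.map f (𝟙 A)) (𝟙 A)
    rw [Category.comp_id, Category.id_comp])

/-! ### The nerve preserves countable colimits (after any colimit-preserving `Φ`) -/

section Colimits

variable [IsTopologicalGroup G]

/-- **`X ↦ (X × A → A)` preserves countable colimits** as a functor into `T[A]` (it does so into
`B^temp(Π)`, `BTemp.preservesColimitsOfShape_prodFunctor_flip_obj`, and the inclusion reflects them).
[cite: MochizukiSemiAnbd2006, Thm A.4 proof p.85] -/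
theorem _root_.Literature.AnabelianGeometry.SemiGraphs.OverPrime.preservesColimitsOfShape_prodA
    (J : Type) [SmallCategory J] [Countable J] : PreservesColimitsOfShape J (OverPrime.prodA A) := by
  haveI : PreservesColimitsOfShape J (OverPrime.prodA A ⋙ (admitsHomTo A).ι) :=
    BTemp.preservesColimitsOfShape_prodFunctor_flip_obj (G := G) A J
  exact preservesColimitsOfShape_of_reflects_of_preserves (OverPrime.prodA A) (admitsHomTo A).ι

variable {D : Type u₃} [Category.{v₃} D]

/-- **The nerve followed by a colimit-preserving functor preserves countable colimits**: for
`Φ : T[A] ⥤ D` preserving colimits of a countable shape `J`, so does `X ↦ Φ(K X ⇉ P X)` (checked at the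
two objects of `WalkingParallelPair`, where it is `prodA ⋙ Φ` and `prodA ⋙ ι ⋙ prodA ⋙ Φ`).  With
`Φ := φ^* ⋙ ι₁` this is the input of "`ψ^*` preserves countable colimits".
[cite: MochizukiSemiAnbd2006, Thm A.4 proof p.85] -/
theorem preservesColimitsOfShape_cechPair_whiskeringRight (Φ : Over' A ⥤ D) (J : Type) [SmallCategory J]
    [Countable J] [PreservesColimitsOfShape J Φ] :
    PreservesColimitsOfShape J (cechPair A ⋙ (Functor.whiskeringRight WalkingParallelPair _ _).obj Φ) := by
  haveI := OverPrime.preservesColimitsOfShape_prodA (G := G) A J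
  haveI : PreservesColimitsOfShape J (admitsHomTo A).ι := overPrime_ι_preservesColimitsOfShape A J
  haveI : ∀ j : WalkingParallelPair, PreservesColimitsOfShape J
      ((cechPair A ⋙ (Functor.whiskeringRight WalkingParallelPair _ _).obj Φ) ⋙
        (evaluation WalkingParallelPair D).obj j) := by
    intro j
    cases j with
    | zero =>
      have e : (cechPair A ⋙ (Functor.whiskeringRight WalkingParallelPair _ _).obj Φ) ⋙
          (evaluation WalkingParallelPair D).obj WalkingParallelPair.zero ≅
          (OverPrime.prodA A ⋙ (admitsHomTo A).ι ⋙ OverPrime.prodA A) ⋙ Φ :=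
        Functor.isoWhiskerRight (cechPairEvalZeroIso A) Φ
      exact preservesColimitsOfShape_of_natIso e.symm
    | one =>
      have e : (cechPair A ⋙ (Functor.whiskeringRight WalkingParallelPair _ _).obj Φ) ⋙
          (evaluation WalkingParallelPair D).obj WalkingParallelPair.one ≅ OverPrime.prodA A ⋙ Φ :=
        Functor.isoWhiskerRight (cechPairEvalOneIso A) Φ
      exact preservesColimitsOfShape_of_natIso e.symm
  exact preservesColimitsOfShape_of_evaluation _ J (fun j => inferInstance)

end Colimits

/-! ### The augmentation `K B ⇉ P B → B` over objects `B` of `T[A]` -/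

/-- **The Čech cofork of an object `B` of `T[A]`, as a cofork IN `T[A]`**: `K B ⇉ P B → B` with
`π = pr₁`. [cite: MochizukiSemiAnbd2006, Thm A.4 pp.82-86] -/
noncomputable def cechCoforkOver (B : Over' A) :
    Cofork (ObjectProperty.homMk (cechk₁ A B.obj) : cechKOver A B.obj ⟶ cechPOver A B.obj)
      (ObjectProperty.homMk (cechk₂ A B.obj)) :=
  Cofork.ofπ (ObjectProperty.homMk prod.fst : cechPOver A B.obj ⟶ B) (by
    ext : 1
    exact cech_condition A B.obj)

/-- The vertex of the Čech cofork over `B` is `B`. [cite: MochizukiSemiAnbd2006, Thm A.4 pp.82-86] -/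
@[simp] theorem cechCoforkOver_pt (B : Over' A) : (cechCoforkOver A B).pt = B := rfl

/-- Its projection is `pr₁ : B × A → B`. [cite: MochizukiSemiAnbd2006, Thm A.4 pp.82-86] -/
@[simp] theorem cechCoforkOver_π_hom (B : Over' A) : (cechCoforkOver A B).π.hom = prod.fst := rfl

/-- **The Čech cofork over `B ∈ T[A]` is a coequaliser IN `T[A]`** (it is one in `B^temp(Π)` by (ii), and
the inclusion `T[A] ⥤ B^temp(Π)` reflects colimits). [cite: MochizukiSemiAnbd2006, Thm A.4 pp.82-86] -/
noncomputable def isColimit_cechCoforkOver (a₀ : A.obj.V) (B : Over' A) : IsColimit (cechCoforkOver A B) :=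
  isColimitOfIsColimitCoforkMap (admitsHomTo A).ι _ (isColimit_cechCofork A a₀ B.obj)

/-- **The augmentation `ι ⋙ cechPair ⟶ const`**: for `B ∈ T[A]` the natural transformation
`(K B ⇉ P B) ⟶ (B ⇉ B)` given by the Čech cofork, natural in `B`.  These are the `cocone`/`naturality`
fields of `ThmA4Cech.CechPresentation` (`nerve := cechPair A`). [cite: MochizukiSemiAnbd2006, Thm A.4 pp.82-86] -/
noncomputable def cechAug :
    (admitsHomTo A).ι ⋙ cechPair A ⟶ Functor.const WalkingParallelPair where
  app B := (cechCoforkOver A B).ι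
  naturality {B B'} f := by
    ext j : 2
    cases j with
    | zero =>
      apply ObjectProperty.hom_ext
      change cechKMap A f.hom ≫ (cechk₁ A B'.obj ≫ prod.fst) = (cechk₁ A B.obj ≫ prod.fst) ≫ f.hom
      simp
    | one =>
      apply ObjectProperty.hom_ext
      change cechPMap A f.hom ≫ prod.fst = prod.fst ≫ f.hom
      simp

/-- The components of the augmentation are the Čech coforks. [cite: MochizukiSemiAnbd2006, Thm A.4 pp.82-86] -/
@[simp] theorem cechAug_app (B : Over' A) : (cechAug A).app B = (cechCoforkOver A B).ι := rfl

/-- **Every component of the augmentation is a colimit cocone in `T[A]`** (the `isColimit` field of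
`ThmA4Cech.CechPresentation` / the binder `haug` of `ThmA4Cech.cechExtensionIso`).
[cite: MochizukiSemiAnbd2006, Thm A.4 pp.82-86] -/
noncomputable def isColimit_cechAug (a₀ : A.obj.V) (B : Over' A) :
    IsColimit (Cocone.mk B ((cechAug A).app B)) :=
  isColimit_cechCoforkOver A a₀ B

end BTemp

end Literature.AnabelianGeometry.SemiGraphs
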